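import Mathlib.Combinatorics.SimpleGraph.Walk.Basic
import Literature.Combinatorics.SimpleGraph.BrinkmannTuckerVanCleemput2021.G70
import HarnessLib

/-!
# Walk certificates for `G70`: the list device

Brinkmann–Tucker–Van Cleemput [BrinkmannTuckerVancleemput2021, §3.1] ask whether Kochol's
74-vertex graph is the smallest snark with a polyhedral embedding; the modules `…G70`, `…Girth`,
`…ClassTwo`, `…Embedding`, `…Verdict` of this directory certify that the 70-vertex cubic graph
`G70` has girth 5, chromatic index 4 and a polyhedral embedding of genus 5.  A *snark* is in
addition cyclically 4-edge-connected (p. 6 of the paper); this module and `…Connectivity`,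
`…CyclicConnectivity` add kernel-checked certificates that `G70` is connected, 3-connected,
3-edge-connected and cyclically 4-edge-connected.

The certificates are explicit systems of walks, written as lists of vertex numbers and checked
by `decide +kernel`.  This module is the device: `walkB a b l` says that the vertex list `l`
is a walk from `a` to `b` (consecutive vertices adjacent in `G70`), `dartsFrom` lists its darts,
`edisj` / `sdisj` are the edge- and (inner-)vertex-disjointness tests, and the soundness lemmas
turn a passing list into a Mathlib `SimpleGraph.Walk` with the listed support and edges
(`exists_walk`) and locate, on a walk leaving a vertex set, a dart across its boundary
(`exists_dart_out`, `exists_dart_in`).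

Provenance: refutations bundle `papers/_cross/refutations` (H21 seat pub-refute-2, 2026-08-18);
written for the tree under the Lean-in-tree rule (human 2026-08-18).
-/

namespace Literature.Combinatorics.SimpleGraph.BrinkmannTuckerVanCleemput2021

open _root_.SimpleGraph

/-- The vertex of `G70` named by a natural number (reduced mod `70`; data are `< 70`).
[folklore] -/
def fin (k : ℕ) : Fin 70 := ⟨k % 70, Nat.mod_lt _ (by decide)⟩

/-- The vertex list of a data walk. [folklore] -/
def W (l : List ℕ) : List (Fin 70) := l.map fin

/-- `chainFrom x t`: the vertices `x :: t` are consecutively adjacent in `G70`. [folklore] -/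
def chainFrom (x : Fin 70) : List (Fin 70) → Bool
  | [] => true
  | y :: t => adjB x y && chainFrom y t

/-- The last vertex of `x :: t`. [folklore] -/
def lastFrom (x : Fin 70) : List (Fin 70) → Fin 70
  | [] => x
  | y :: t => lastFrom y t

/-- The darts (ordered consecutive pairs) of `x :: t`. [folklore] -/
def dartsFrom (x : Fin 70) : List (Fin 70) → List (Fin 70 × Fin 70)
  | [] => []
  | y :: t => (x, y) :: dartsFrom y t

/-- The darts of a vertex list. [folklore] -/
def dartsL : List (Fin 70) → List (Fin 70 × Fin 70)
  | [] => []
  | x :: t => dartsFrom x t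

/-- `walkB a b l`: the vertex list `l` is a walk of `G70` from `a` to `b`. [folklore] -/
def walkB (a b : Fin 70) : List (Fin 70) → Bool
  | [] => false
  | x :: t => decide (x = a) && chainFrom x t && decide (lastFrom x t = b)

/-- Two vertex lists have no edge in common (in either orientation). [folklore] -/
def edisj (l m : List (Fin 70)) : Bool :=
  (dartsL l).all fun e => (dartsL m).all fun e' => decide (e ≠ e') && decide (e ≠ e'.swap)

/-- Every vertex of `l` other than `h` and `a` is absent from `m` (for walks from `h` to `a`:
the two walks are internally vertex-disjoint). [folklore] -/
def sdisj (h a : Fin 70) (l m : List (Fin 70)) : Bool :=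
  l.all fun x => decide (x = h) || decide (x = a) || m.all fun x' => decide (x ≠ x')

/-- Soundness of `chainFrom`: a consecutively adjacent list is the support of a walk of `G70`
whose edges are those of the listed darts. [folklore] -/
theorem exists_walk_of_chainFrom : ∀ (t : List (Fin 70)) (x : Fin 70), chainFrom x t = true →
    ∃ p : G70.Walk x (lastFrom x t), p.support = x :: t ∧
      p.edges = (dartsFrom x t).map fun d => s(d.1, d.2)
  | [], x, _ => ⟨Walk.nil, rfl, rfl⟩
  | y :: t, x, h => by
    simp only [chainFrom, Bool.and_eq_true] at h
    obtain ⟨p, hp, he⟩ := exists_walk_of_chainFrom t y h.2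
    dsimp only [lastFrom, dartsFrom]
    exact ⟨Walk.cons (h.1 : G70.Adj x y) p, by rw [Walk.support_cons, hp],
      by rw [Walk.edges_cons, he, List.map_cons]⟩

/-- Soundness of `walkB`: a passing list is the support of a walk from `a` to `b` whose edges
are those of its darts. [folklore] -/
theorem exists_walk {a b : Fin 70} {l : List (Fin 70)} (h : walkB a b l = true) :
    ∃ p : G70.Walk a b, p.support = l ∧ p.edges = (dartsL l).map fun d => s(d.1, d.2) := by
  cases l with
  | nil => simp [walkB] at h
  | cons x t =>
    simp only [walkB, Bool.and_eq_true, decide_eq_true_eq] at h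
    obtain ⟨⟨rfl, hc⟩, rfl⟩ := h
    exact exists_walk_of_chainFrom t x hc

/-- A consecutively adjacent list that starts in `A` and ends outside `A` has a dart from `A`
to its complement. [folklore] -/
theorem exists_dart_out_of_chainFrom (A : Finset (Fin 70)) : ∀ (t : List (Fin 70)) (x : Fin 70),
    chainFrom x t = true → x ∈ A → lastFrom x t ∉ A →
    ∃ e ∈ dartsFrom x t, e.1 ∈ A ∧ e.2 ∉ A ∧ G70.Adj e.1 e.2
  | [], x, _, hx, hl => absurd hx hl
  | y :: t, x, h, hx, hl => by
    simp only [chainFrom, Bool.and_eq_true] at h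
    by_cases hy : y ∈ A
    · obtain ⟨e, he, h1⟩ := exists_dart_out_of_chainFrom A t y h.2 hy hl
      exact ⟨e, List.mem_cons_of_mem _ he, h1⟩
    · exact ⟨(x, y), List.mem_cons_self, hx, hy, (h.1 : G70.Adj x y)⟩

/-- A consecutively adjacent list that starts outside `S` and ends in `S` has a dart entering
`S`. [folklore] -/
theorem exists_dart_in_of_chainFrom (S : Finset (Fin 70)) : ∀ (t : List (Fin 70)) (x : Fin 70),
    chainFrom x t = true → x ∉ S → lastFrom x t ∈ S →
    ∃ e ∈ dartsFrom x t, e.1 ∉ S ∧ e.2 ∈ S ∧ G70.Adj e.1 e.2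
  | [], x, _, hx, hl => absurd hl hx
  | y :: t, x, h, hx, hl => by
    simp only [chainFrom, Bool.and_eq_true] at h
    by_cases hy : y ∈ S
    · exact ⟨(x, y), List.mem_cons_self, hx, hy, (h.1 : G70.Adj x y)⟩
    · obtain ⟨e, he, h1⟩ := exists_dart_in_of_chainFrom S t y h.2 hy hl
      exact ⟨e, List.mem_cons_of_mem _ he, h1⟩

/-- A walk (as a passing list) from a vertex of `A` to a vertex outside `A` has a dart from `A`
to its complement. [folklore] -/
theorem exists_dart_out {A : Finset (Fin 70)} {a b : Fin 70} {l : List (Fin 70)}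
    (h : walkB a b l = true) (ha : a ∈ A) (hb : b ∉ A) :
    ∃ e ∈ dartsL l, e.1 ∈ A ∧ e.2 ∉ A ∧ G70.Adj e.1 e.2 := by
  cases l with
  | nil => simp [walkB] at h
  | cons x t =>
    simp only [walkB, Bool.and_eq_true, decide_eq_true_eq] at h
    obtain ⟨⟨rfl, hc⟩, rfl⟩ := h
    exact exists_dart_out_of_chainFrom A t x hc ha hb

/-- A walk (as a passing list) from outside `S` into `S` has a dart entering `S`. [folklore] -/
theorem exists_dart_in {S : Finset (Fin 70)} {a b : Fin 70} {l : List (Fin 70)}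
    (h : walkB a b l = true) (ha : a ∉ S) (hb : b ∈ S) :
    ∃ e ∈ dartsL l, e.1 ∉ S ∧ e.2 ∈ S ∧ G70.Adj e.1 e.2 := by
  cases l with
  | nil => simp [walkB] at h
  | cons x t =>
    simp only [walkB, Bool.and_eq_true, decide_eq_true_eq] at h
    obtain ⟨⟨rfl, hc⟩, rfl⟩ := h
    exact exists_dart_in_of_chainFrom S t x hc ha hb

/-- Soundness of `edisj`: no dart of `l` equals a dart of `m` or its reverse. [folklore] -/
theorem edisj_sound {l m : List (Fin 70)} (h : edisj l m = true) {e e' : Fin 70 × Fin 70}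
    (he : e ∈ dartsL l) (he' : e' ∈ dartsL m) : e ≠ e' ∧ e ≠ e'.swap := by
  simp only [edisj, List.all_eq_true, Bool.and_eq_true, decide_eq_true_eq] at h
  exact h e he e' he'

/-- Soundness of `edisj` on edges: the walks share no edge. [folklore] -/
theorem edisj_edge {l m : List (Fin 70)} (h : edisj l m = true) {e e' : Fin 70 × Fin 70}
    (he : e ∈ dartsL l) (he' : e' ∈ dartsL m) : s(e.1, e.2) ≠ s(e'.1, e'.2) := by
  intro hs
  obtain ⟨h1, h2⟩ := edisj_sound h he he'
  rcases Sym2.eq_iff.1 hs with ⟨h3, h4⟩ | ⟨h3, h4⟩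
  · exact h1 (Prod.ext h3 h4)
  · exact h2 (Prod.ext h3 h4)

/-- Soundness of `sdisj`: a vertex of `l` other than the two ends is not on `m`. [folklore] -/
theorem sdisj_sound {h a : Fin 70} {l m : List (Fin 70)} (hs : sdisj h a l m = true)
    {x : Fin 70} (hx : x ∈ l) (hh : x ≠ h) (ha : x ≠ a) : x ∉ m := by
  simp only [sdisj, List.all_eq_true, Bool.or_eq_true, decide_eq_true_eq] at hs
  rcases hs x hx with (rfl | rfl) | h3
  · exact absurd rfl hh
  · exact absurd rfl ha
  · exact fun hm => h3 x hm rfl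

end Literature.Combinatorics.SimpleGraph.BrinkmannTuckerVanCleemput2021
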